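import Summits.QuantumFields.YangMills.Theorems.BalabanUVNodesN15KingModelTwoPointOptimalDecay
import Summits.QuantumFields.YangMills.Theorems.BalabanUVNodesN15KingModelSchwingerFunctionsHafnian
import Summits.QuantumFields.YangMills.Theorems.BalabanUVNodesN15KingModelTwoPointInfiniteVolumeSymmetry
import Literature.Combinatorics.Enumerative.HafnianWickSum

/-!
# BalabanUVNodes ∕ N15 — THE KING-MODEL RUNG (PART Ϸ-d): THE THERMODYNAMIC LIMIT OF EVERY `n`-POINT SCHWINGER FUNCTION OF THE FREE BLOCK FIELD —
# `∫∏_{i∈S}φ(z_i mod Ω_k) dρ_{P_∞,Ω_k} → Haf((S₂^{ℝ}(z_v − z_u))_{u,v∈S})` as all periods of `Ω_k` tend to `∞`; the infinite-volume `n`-point functions are hafnians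
# of `S₂^{ℝ}`, vanish for odd `n`, and the connected four-point function clusters at the optimal rate: `|S₄ − S(01)S(23)| ≤ m⁻²K_d(c,m)(e^{−c|(z₂−z₀)_ν|} + e^{−c|(z₃−z₀)_ν|})`
# (Track A, DAG node N15 = NE2; FAN-OUT v1.1 §N15 s3 «KING-MODEL RUNG»; uses parts Ͱ-c (hafnian forms, hafnian continuity), Ϝ-j (thermodynamic limit of `S₂`), Ϸ-c (optimal decay);
# count-neutral)

HONEST FRAMING.  Count-neutral (cell `pub-ymgap`, seat `pub-ymgap-dag-n15-e` g34; `--supports stmt-QuantumFields-27366 --as helper` = K3⁸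
`SpineGivenEndpointR13SepCoPHV`).  King's `A = 0`, `g = 0` model ([King1986] C. King, Commun. Math. Phys. **102** (1986) 649–677): part Ϝ-j proved the thermodynamic
limit of the block-smeared two-point function of the `K = ∞` block field, `S₂^{(∞)}_{Ω_k}(0, z mod Ω_k) → S₂^{ℝ}(z)` along any tori with all periods `→ ∞`; part Ͱ-c
wrote every `n`-point function of the law `ρ_{P_∞}` as the hafnian of `S₂^{(∞)}` on the points.  Since the hafnian is continuous in its entries (part Ͱ-c) and
`S₂^{(∞)}` is translation invariant, EVERY `n`-point function converges in the thermodynamic limit to the hafnian of the infinite-volume kernel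
`(S₂^{ℝ}(z_v − z_u))_{u,v∈S}` — the free field's infinite-volume Schwinger functions exist and are Wick polynomials of `S₂^{ℝ}` (Glimm–Jaffe §6.2 for the
block-averaged free field; folklore).  With part Ϸ-c's optimal decay, the connected four-point function `S₄ − S₂(z₁,z₂)S₂(z₃,z₄)` of the limit — the two
«exchange» pairings — is bounded by `m⁻²K_d(c,m)(e^{−c|(z₂−z₀)_ν|} + e^{−c|(z₃−z₀)_ν|})`: each exchange pairing carries one optimally decaying factor (part Ϸ-c) and one
factor `≤ m⁻²` (part Ϝ-j).  NOT a node discharge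
(N15 is booked through n15-a's knit, untouched here); nothing Bałaban ∕ continuum-Yang–Mills ∕ `ℝ⁴` ∕ OS ∕ Clay; the «mass» is the free field's `m`.
0 `sorry`, 0 def; standard axioms.

WHAT THIS FILE PROVES (kernel).  §1 `intCast_sub_eq` (plumbing), ★ `kingS2Lim_intCast_eq_sub` (`S₂^{(∞)}_Ω(z_u, z_v) = S₂^{(∞)}_Ω(0, z_v − z_u)` on lattice points), ★★
`tendsto_kingS2Lim_intCast_volume` (two-point function at two lattice points → `S₂^{ℝ}(z_v − z_u)`); §2 ★★★ **`tendsto_integral_prod_eval_fineBlockLawLim_volume`**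
(THE THERMODYNAMIC LIMIT OF EVERY `n`-POINT FUNCTION: `→ Haf((S₂^{ℝ}(z_v − z_u))_{u,v∈S})`); §3 the infinite-volume Schwinger functions: `hafnian_kingS2Inf_eq_zero_of_odd`
(odd `n`), ★ `hafnian_kingS2Inf_two` (`n = 2`: `S₂^{ℝ}(z₂ − z₁)`), ★★ `hafnian_kingS2Inf_four` (`n = 4`: the three pairings), ★★ **`abs_fourPoint_connected_le`**
(the connected four-point function of the limit is bounded by `m⁻²K_d(c,m)(e^{−c|(z₂−z₀)_ν|} + e^{−c|(z₃−z₀)_ν|})`).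

HONEST SCOPE.  King's free model; no infinite-volume MEASURE is constructed here (only the limits of the moments); constants not optimised.  N15 untouched; counts unmoved.
Locators (use): [King1986] Thm 2.1 (2.22)–(2.23) p.654, Thm 3.3 (3.6) p.655, (4.5) p.670.
-/

noncomputable section

open scoped BigOperators Topology
open Filter MeasureTheory

namespace Summit.QuantumFields.YangMills.BalabanUVNodes.N15KingModelRung

open Literature.MathematicalPhysics.QuantumFieldTheory.Balaban1983to89.B5Prop11Plancherel (Tor)
open Literature.Combinatorics.Enumerative (hafnian)
open Literature.Combinatorics.Enumerative.HafnianGeneratingFunction (subMat)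
open FreeField OptimalDecay

variable {d : ℕ}

/-! ## §1 The two-point function at two lattice points, and its thermodynamic limit -/

section TwoPoint

variable (M : Fin (d + 1) → ℕ) [hM : ∀ ν, NeZero (M ν)]

omit hM in
/-- Casting a difference of lattice points to the torus: `(z_v mod Ω) − (z_u mod Ω) = (z_v − z_u) mod Ω`. [folklore] -/
theorem intCast_sub_eq (zu zv : Fin (d + 1) → ℤ) :
    (fun ν => ((zv ν : ℤ) : ZMod (M ν))) - (fun ν => ((zu ν : ℤ) : ZMod (M ν))) = fun ν => (((zv - zu) ν : ℤ) : ZMod (M ν)) := by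
  funext ν
  simp [Pi.sub_apply, Int.cast_sub]

/-- ★ **Translation invariance on lattice points**: `S₂^{(∞)}_Ω(z_u mod Ω, z_v mod Ω) = S₂^{(∞)}_Ω(0, (z_v − z_u) mod Ω)`. [cite: King1986, (2.14) p.653] -/
theorem kingS2Lim_intCast_eq_sub (m2 : ℝ) (zu zv : Fin (d + 1) → ℤ) :
    kingS2Lim M m2 (fun ν => ((zu ν : ℤ) : ZMod (M ν))) (fun ν => ((zv ν : ℤ) : ZMod (M ν)))
      = kingS2Lim M m2 0 (fun ν => (((zv - zu) ν : ℤ) : ZMod (M ν))) := by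
  have h := kingS2Lim_transl M m2 (fun ν => ((zu ν : ℤ) : ZMod (M ν))) (fun ν => ((zv ν : ℤ) : ZMod (M ν)))
    (-(fun ν => ((zu ν : ℤ) : ZMod (M ν))))
  rw [add_neg_cancel, ← sub_eq_add_neg, intCast_sub_eq M zu zv] at h
  exact h.symm

end TwoPoint

/-- ★★ **The two-point function at two lattice points converges** to `S₂^{ℝ}(z_v − z_u)` along any tori with all periods `→ ∞`.
[cite: King1986, Thm 2.1 (2.22)–(2.23) p.654] -/
theorem tendsto_kingS2Lim_intCast_volume {m2 : ℝ} (hm : 0 < m2) (Mseq : ℕ → Fin (d + 1) → ℕ) (hpos : ∀ k ν, 0 < Mseq k ν)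
    (hlim : ∀ ν, Tendsto (fun k => (Mseq k ν : ℝ)) atTop atTop) (zu zv : Fin (d + 1) → ℤ) :
    Tendsto (fun k => haveI : ∀ ν, NeZero (Mseq k ν) := fun ν => ⟨(hpos k ν).ne'⟩
      kingS2Lim (Mseq k) m2 (fun ν => ((zu ν : ℤ) : ZMod (Mseq k ν))) (fun ν => ((zv ν : ℤ) : ZMod (Mseq k ν)))) atTop
      (𝓝 (kingS2Inf m2 (zv - zu))) := by
  have h := tendsto_kingS2Lim_volume hm Mseq hpos hlim (zv - zu)
  refine h.congr fun k => ?_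
  haveI : ∀ ν, NeZero (Mseq k ν) := fun ν => ⟨(hpos k ν).ne'⟩
  exact (kingS2Lim_intCast_eq_sub (Mseq k) m2 zu zv).symm

/-! ## §2 The thermodynamic limit of every `n`-point function -/

section NPoint

variable {W : Type*} [DecidableEq W] [LinearOrder W]

/-- ★★★ **THE THERMODYNAMIC LIMIT OF EVERY `n`-POINT SCHWINGER FUNCTION OF THE FREE BLOCK FIELD**: for lattice points `z : W → ℤ^{d+1}`, a finite `S`, `m² > 0`, and
ANY sequence of unit tori `Ω_k` with all periods `→ ∞`,
`∫∏_{i∈S}φ(z_i mod Ω_k) ρ_{P_∞,Ω_k}(φ)dφ → Haf((S₂^{ℝ}(z_v − z_u))_{u,v∈S})` — the infinite-volume `n`-point functions of the `K = ∞` block field exist and are the Wick polynomials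
(hafnians) of the infinite-volume two-point function. [cite: King1986, Thm 2.1 (2.22)–(2.23) p.654] -/
theorem tendsto_integral_prod_eval_fineBlockLawLim_volume {m2 : ℝ} (hm : 0 < m2) (Mseq : ℕ → Fin (d + 1) → ℕ) (hpos : ∀ k ν, 0 < Mseq k ν)
    (hlim : ∀ ν, Tendsto (fun k => (Mseq k ν : ℝ)) atTop atTop) (z : W → Fin (d + 1) → ℤ) (S : Finset W) :
    Tendsto (fun k => haveI : ∀ ν, NeZero (Mseq k ν) := fun ν => ⟨(hpos k ν).ne'⟩
      ∫ φ : Tor (Mseq k) → ℝ, (∏ i ∈ S, φ (fun ν => ((z i ν : ℤ) : ZMod (Mseq k ν)))) * gaussDensity (fineBlockPrecLim (Mseq k) m2) φ) atTop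
      (𝓝 (hafnian (subMat (Matrix.of fun u v : W => kingS2Inf m2 (z v - z u)) S))) := by
  have hL : 2 ≤ 3 := by norm_num
  have hLodd : Odd 3 := by decide
  have e : (fun k => haveI : ∀ ν, NeZero (Mseq k ν) := fun ν => ⟨(hpos k ν).ne'⟩
      ∫ φ : Tor (Mseq k) → ℝ, (∏ i ∈ S, φ (fun ν => ((z i ν : ℤ) : ZMod (Mseq k ν)))) * gaussDensity (fineBlockPrecLim (Mseq k) m2) φ)
      = fun k => haveI : ∀ ν, NeZero (Mseq k ν) := fun ν => ⟨(hpos k ν).ne'⟩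
          hafnian (subMat (Matrix.of fun u v : W =>
            kingS2Lim (Mseq k) m2 (fun ν => ((z u ν : ℤ) : ZMod (Mseq k ν))) (fun ν => ((z v ν : ℤ) : ZMod (Mseq k ν)))) S) := by
    funext k
    haveI : ∀ ν, NeZero (Mseq k ν) := fun ν => ⟨(hpos k ν).ne'⟩
    exact integral_prod_eval_fineBlockLawLim_eq_hafnian 3 (Mseq k) hLodd hL hm _ S
  rw [e]
  exact tendsto_hafnian_of_entries fun u v => tendsto_kingS2Lim_intCast_volume hm Mseq hpos hlim (z u) (z v)

end NPoint

/-! ## §3 The infinite-volume Schwinger functions: parity, `n = 2`, `n = 4`, and clustering of the connected four-point function -/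

section InfiniteVolume

variable {W : Type*} [DecidableEq W] [LinearOrder W]

/-- Odd infinite-volume `n`-point functions vanish. [folklore] -/
theorem hafnian_kingS2Inf_eq_zero_of_odd (m2 : ℝ) (z : W → Fin (d + 1) → ℤ) {S : Finset W} (hodd : Odd S.card) :
    hafnian (subMat (Matrix.of fun u v : W => kingS2Inf m2 (z v - z u)) S) = 0 :=
  hafnian_eq_zero_of_odd_card (by rwa [Fintype.card_coe]) _

/-- ★ **`n = 2`**: the infinite-volume two-point function at `z₁, z₂` is `S₂^{ℝ}(z₂ − z₁)`. [cite: King1986, Thm 2.1 (2.22) p.654] -/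
theorem hafnian_kingS2Inf_two (m2 : ℝ) (z : Fin 2 → Fin (d + 1) → ℤ) :
    hafnian (Matrix.of fun u v : Fin 2 => kingS2Inf m2 (z v - z u)) = kingS2Inf m2 (z 1 - z 0) := by
  rw [Literature.Combinatorics.Enumerative.HafnianExpansion.hafnian_fin_eq_sum_row_zero,
    show (Finset.univ : Finset (Fin 2)).erase 0 = {1} by decide, Finset.sum_singleton]
  haveI : IsEmpty (Literature.Combinatorics.Enumerative.HafnianExpansion.Compl2 (0 : Fin 2) 1) :=
    ⟨fun x => by rcases x with ⟨x, h0, h1⟩; fin_cases x <;> simp_all⟩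
  rw [Literature.Combinatorics.Enumerative.HafnianExpansion.hafnian_of_isEmpty, mul_one, Matrix.of_apply]

/-- ★★ **`n = 4`: THE THREE PAIRINGS** — `Haf((S₂^{ℝ}(z_v−z_u))_{u,v<4}) = S(01)S(23) + S(02)S(13) + S(03)S(12)`, `S(uv) = S₂^{ℝ}(z_v − z_u)` (via the bridge to the tree's `wickSum` and
its `wickSum_four`). [folklore] -/
theorem hafnian_kingS2Inf_four (m2 : ℝ) (z : Fin 4 → Fin (d + 1) → ℤ) :
    hafnian (Matrix.of fun u v : Fin 4 => kingS2Inf m2 (z v - z u))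
      = kingS2Inf m2 (z 1 - z 0) * kingS2Inf m2 (z 3 - z 2) + kingS2Inf m2 (z 2 - z 0) * kingS2Inf m2 (z 3 - z 1)
        + kingS2Inf m2 (z 3 - z 0) * kingS2Inf m2 (z 2 - z 1) := by
  have hsymm : ∀ a b : Fin 4, kingS2Inf m2 (z b - z a) = kingS2Inf m2 (z a - z b) := fun a b => by
    rw [← kingS2Inf_neg m2 (z a - z b), neg_sub]
  rw [← Literature.Combinatorics.Enumerative.HafnianWickSum.wickSum_univ_eq_hafnian (fun u v : Fin 4 => kingS2Inf m2 (z v - z u)) hsymm,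
    show (Finset.univ : Finset (Fin 4)) = {0, 1, 2, 3} by decide,
    Literature.MathematicalPhysics.QuantumFieldTheory.Balaban1983to89.HiggsFluctMeasureWickSum.wickSum_four _ (by decide) (by decide) (by decide)]

/-- ★★ **CLUSTERING OF THE CONNECTED FOUR-POINT FUNCTION AT THE OPTIMAL RATE**: the two exchange pairings of the infinite-volume four-point function satisfy, for every
`0 < c` with `c² < m²` and every coordinate `ν`,
`|S(02)S(13) + S(03)S(12)| ≤ m⁻²·K_d(c,m)·(e^{−c|(z₂−z₀)_ν|} + e^{−c|(z₃−z₀)_ν|})` (`K_d` of part Ϸ-c; `|S| ≤ m⁻²`, part Ϝ-j) — when the pair `{z₀,z₁}` is far from `{z₂,z₃}`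
in the `ν`-th coordinate, the four-point function factorises up to an optimally small error. [cite: King1986, Thm 3.3 (3.6) p.655] -/
theorem abs_fourPoint_connected_le {m2 c : ℝ} (hm : 0 < m2) (hc0 : 0 < c) (hc : c ^ 2 < m2) (z : Fin 4 → Fin (d + 1) → ℤ) (ν : Fin (d + 1)) :
    |kingS2Inf m2 (z 2 - z 0) * kingS2Inf m2 (z 3 - z 1) + kingS2Inf m2 (z 3 - z 0) * kingS2Inf m2 (z 2 - z 1)|
      ≤ m2⁻¹ * (((2 * Real.pi) ^ (d + 1))⁻¹ * (2 * Real.pi * (1 + Real.cosh c) / (c * (m2 - c ^ 2))) * ((17 + 16 * Real.pi ^ 2) * Real.pi) ^ d)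
          * (Real.exp (-(c * |((z 2 - z 0) ν : ℝ)|)) + Real.exp (-(c * |((z 3 - z 0) ν : ℝ)|))) := by
  set K : ℝ := ((2 * Real.pi) ^ (d + 1))⁻¹ * (2 * Real.pi * (1 + Real.cosh c) / (c * (m2 - c ^ 2))) * ((17 + 16 * Real.pi ^ 2) * Real.pi) ^ d with hK
  have h20 := abs_kingS2Inf_le_exp_of_sq_lt hm hc0 hc (z 2 - z 0) ν
  have h30 := abs_kingS2Inf_le_exp_of_sq_lt hm hc0 hc (z 3 - z 0) ν
  have h31 := abs_kingS2Inf_le hm (z 3 - z 1)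
  have h21 := abs_kingS2Inf_le hm (z 2 - z 1)
  have hK0 : 0 ≤ K := by
    have : 0 < m2 - c ^ 2 := by linarith
    positivity
  refine (abs_add_le _ _).trans ?_
  rw [abs_mul, abs_mul]
  have e1 : |kingS2Inf m2 (z 2 - z 0)| * |kingS2Inf m2 (z 3 - z 1)| ≤ K * Real.exp (-(c * |((z 2 - z 0) ν : ℝ)|)) * m2⁻¹ :=
    mul_le_mul h20 h31 (abs_nonneg _) (mul_nonneg hK0 (Real.exp_pos _).le)
  have e2 : |kingS2Inf m2 (z 3 - z 0)| * |kingS2Inf m2 (z 2 - z 1)| ≤ K * Real.exp (-(c * |((z 3 - z 0) ν : ℝ)|)) * m2⁻¹ :=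
    mul_le_mul h30 h21 (abs_nonneg _) (mul_nonneg hK0 (Real.exp_pos _).le)
  calc |kingS2Inf m2 (z 2 - z 0)| * |kingS2Inf m2 (z 3 - z 1)| + |kingS2Inf m2 (z 3 - z 0)| * |kingS2Inf m2 (z 2 - z 1)|
      ≤ K * Real.exp (-(c * |((z 2 - z 0) ν : ℝ)|)) * m2⁻¹ + K * Real.exp (-(c * |((z 3 - z 0) ν : ℝ)|)) * m2⁻¹ := add_le_add e1 e2
    _ = m2⁻¹ * K * (Real.exp (-(c * |((z 2 - z 0) ν : ℝ)|)) + Real.exp (-(c * |((z 3 - z 0) ν : ℝ)|))) := by ring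

end InfiniteVolume

end Summit.QuantumFields.YangMills.BalabanUVNodes.N15KingModelRung
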